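import Summits.CriticalPhenomena.PercolationContinuityZ3.Theorems.PercNearOneGluingNoHeavyPcintNawChainMemAlong
import HarnessLib

/-!
# PCINT lane, reduction B2c on the dangerous-set automaton — payment records, their injectivity, and the coin averaging

Cell `prim-pcint` (PAPER-2 track (iii)), seat `prim-pcint-1` (gen 5); support file (`--supports stmt-CriticalPhenomena-4575`).
Does NOT build on p205010.  Memo: run/shared/lean/prim/pcint/REDUCTIONS.md §B2c (prim-pcint-2 gen 3), §B2c.7 (reduced states).

The payment SLOTS of the world of a sibling order `o` (`cslots`: per step, the included letters and the included letters with
a bonus) and their RECORDS (`crec`: (site, paid incidence index)); `crec_mem_cincSet` (records are incidences of `o`-forced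
sites) and `crec_injOn` (REDUCTIONS §B2c.3: each incidence is paid at most once — the bonus pays the last incidence before the
new one, `no_incidence_between`).  Plus the averaging identity `sum_orders_prod_coin` for fair corner coins with
step-dependent exponents (generalising `sum_orders_pow_card_badTimes` of `…PcintNawRandReduction`).
-/

noncomputable section

namespace Summit.CriticalPhenomena.PercolationContinuityZ3.Theorems.Pcint

open Finset Literature.Probability.Percolation Literature.Probability.LatticeModels
open Literature.Probability.FitznerVanDerHofstad2017 (wordPos_wordInit)

variable {{d : ℕ}}

/-! ### Payment records and their injectivity -/

section Records

open Classical

variable (a₀ : Fin d × Bool) {τ kc n : ℕ} {γ : Fin n → Fin d × Bool}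

/-- The minimal visible age (junk `0` when there is no visible incidence). [folklore] -/
def cminAge (S : MState d) (a b : Fin d × Bool) : ℕ :=
  if h : (cvis S a b).Nonempty then ((cvis S a b).image Prod.snd).min' (h.image _) else 0

/-- A bonus witness has the minimal visible age. [folklore] -/
theorem cminAge_eq_of_bonusWit {S : MState d} {a b : Fin d × Bool} {q₁ : Site d × ℕ} (h : bonusWit τ kc S a b q₁ = true) :
    cminAge S a b = q₁.2 := by
  obtain ⟨hq₁, -, hall⟩ := (bonusWit_iff τ kc).1 h
  have hne : (cvis S a b).Nonempty := ⟨q₁, hq₁⟩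
  rw [cminAge, dif_pos hne]
  apply le_antisymm
  · exact Finset.min'_le _ _ (mem_image_of_mem _ hq₁)
  · apply Finset.le_min'
    intro j hj
    obtain ⟨q, hq, rfl⟩ := mem_image.1 hj
    rcases hall q hq with h | h <;> omega

/-- The minimal visible age is a visible age. [folklore] -/
theorem exists_cvis_cminAge {S : MState d} {a b : Fin d × Bool} (hne : (cvis S a b).Nonempty) :
    ∃ q ∈ cvis S a b, q.2 = cminAge S a b := by
  rw [cminAge, dif_pos hne]
  have := Finset.min'_mem ((cvis S a b).image Prod.snd) (hne.image _)
  obtain ⟨q, hq, hq2⟩ := mem_image.1 this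
  exact ⟨q, hq, hq2⟩

/-- Every visible age is at least the minimal one. [folklore] -/
theorem cminAge_le {S : MState d} {a b : Fin d × Bool} {q : Site d × ℕ} (hq : q ∈ cvis S a b) : cminAge S a b ≤ q.2 := by
  rw [cminAge, dif_pos ⟨q, hq⟩]
  exact Finset.min'_le _ _ (mem_image_of_mem _ hq)

variable (τ kc γ)

/-- The letters INCLUDED in the world of the order `o` at step `t`: active, and unconditional or (corner and the corner of
steps `t-1, t` is bad for `o`). [folklore] -/
def cinc (o : Orders d n) (t : ℕ) (ht : t < n) : Finset (Fin d × Bool) :=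
  univ.filter fun b => cactive kc (danger τ (pre a₀ γ t)) (γ ⟨t, ht⟩) b = true ∧
    (cuncond (danger τ (pre a₀ γ t)) (γ ⟨t, ht⟩) b = true ∨
      (ccorner (danger τ (pre a₀ γ t)) b = true ∧ IsBad o γ (t - 1)))

/-- The record of a payment slot `(t, β, b)`: the neighbour site, and the paid incidence index (`t+1` for the new incidence,
`t - j₁` for the bonus). [folklore] -/
def crec (x : ℕ × Bool × (Fin d × Bool)) : Site d × ℕ :=
  (nsite γ x.1 x.2.2, if x.2.1 then x.1 - cminAge (danger τ (pre a₀ γ x.1)) (wordAt a₀ γ x.1) x.2.2 else x.1 + 1)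

/-- The payment slots of the world of `o`: for each step `t < n`, the included letters (new-incidence slots, tag `false`) and the
included letters with a bonus (bonus slots, tag `true`). [folklore] -/
def cslots (o : Orders d n) : Finset (ℕ × Bool × (Fin d × Bool)) :=
  (range n).attach.biUnion fun t =>
    ((cinc a₀ τ kc γ o t.1 (mem_range.1 t.2)).image fun b => (t.1, false, b)) ∪
    (((cinc a₀ τ kc γ o t.1 (mem_range.1 t.2)).filter fun b =>
        cbonus τ kc (danger τ (pre a₀ γ t.1)) (γ ⟨t.1, mem_range.1 t.2⟩) b = true).image fun b => (t.1, true, b))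

/-- The incidences of `o`-forced sites, as pairs (site, index). [folklore] -/
def cincSet (o : Orders d n) : Finset (Site d × ℕ) :=
  (forcedSites o γ).biUnion fun w => (incTimes γ w).image fun i => (w, i)

variable {τ kc γ}

/-- Membership in the slot set. [folklore] -/
theorem mem_cslots {o : Orders d n} {x : ℕ × Bool × (Fin d × Bool)} :
    x ∈ cslots a₀ τ kc γ o ↔ ∃ ht : x.1 < n, x.2.2 ∈ cinc a₀ τ kc γ o x.1 ht ∧
      (x.2.1 = true → cbonus τ kc (danger τ (pre a₀ γ x.1)) (γ ⟨x.1, ht⟩) x.2.2 = true) := by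
  rcases x with ⟨t, β, b⟩
  simp only [cslots, mem_biUnion, mem_attach, true_and, Subtype.exists, mem_range, mem_union, mem_image, mem_filter,
    Prod.mk.injEq]
  constructor
  · rintro ⟨t', ht', (⟨b', hb', rfl, hβ, rfl⟩ | ⟨b', ⟨hb', hbo⟩, rfl, hβ, rfl⟩)⟩
    · exact ⟨ht', hb', fun h => by rw [← hβ] at h; exact Bool.noConfusion h⟩
    · exact ⟨ht', hb', fun _ => hbo⟩
  · rintro ⟨ht, hb, hβ⟩
    refine ⟨t, ht, ?_⟩
    cases β
    · exact Or.inl ⟨b, hb, rfl, rfl, rfl⟩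
    · exact Or.inr ⟨b, ⟨hb, hβ rfl⟩, rfl, rfl, rfl⟩

/-- The size of the incidence set: `Σ_{w forced} #incTimes γ w`. [folklore] -/
theorem card_cincSet (o : Orders d n) : (cincSet γ o).card = ∑ w ∈ forcedSites o γ, (incTimes γ w).card := by
  rw [cincSet, card_biUnion]
  · exact sum_congr rfl fun w _ => card_image_of_injective _ fun i j h => by simpa using h
  · intro w _ w' _ hww
    simp only [Function.onFun]
    rw [Finset.disjoint_left]
    rintro x hx hx'
    obtain ⟨i, -, rfl⟩ := mem_image.1 hx
    obtain ⟨i', -, h⟩ := mem_image.1 hx'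
    exact hww (by simpa using (congrArg Prod.fst h).symm)

/-- **Records are incidences of forced sites.** [folklore] -/
theorem crec_mem_cincSet (hs : IsSAW γ) (hch : chordEdges γ = ∅) {o : Orders d n} {x : ℕ × Bool × (Fin d × Bool)}
    (hx : x ∈ cslots a₀ τ kc γ o) : crec a₀ τ γ x ∈ cincSet γ o := by
  obtain ⟨ht, hb, hβ⟩ := (mem_cslots a₀).1 hx
  rcases x with ⟨t, β, b⟩
  simp only at ht hb hβ
  obtain ⟨hact, hrest⟩ := (mem_filter.1 hb).2
  have hforced : nsite γ t b ∈ forcedSites o γ := by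
    rcases hrest with hunc | ⟨hcor, hbad⟩
    · exact forced_of_cuncond a₀ hch o ht hunc
    · have ht1 : 1 ≤ t := by
        by_contra h0
        have : t = 0 := by omega
        subst this
        obtain ⟨-, q, hq, -⟩ := (cactive_iff kc).1 hact
        have := (mem_cvis.1 hq).1
        rw [show pre a₀ γ 0 = (fun i : Fin 0 => wordAt a₀ γ i.1) from rfl, danger_zero] at this
        exact notMem_empty _ this
      exact forced_of_ccorner a₀ hs hch o ht ht1 hact hcor hbad
  rw [cincSet, mem_biUnion]
  refine ⟨nsite γ t b, hforced, mem_image.2 ⟨_, ?_, rfl⟩⟩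
  cases β
  · simpa [crec] using succ_mem_incTimes (γ := γ) ht b
  · simp only [if_true]
    obtain ⟨q₁, hq₁⟩ := (cbonus_iff τ kc).1 (hβ rfl)
    have e1 : wordAt a₀ γ t = γ ⟨t, ht⟩ := wordAt_of_lt a₀ γ ht
    rw [e1, cminAge_eq_of_bonusWit hq₁]
    exact sub_mem_incTimes a₀ ht ((bonusWit_iff τ kc).1 hq₁).1

/-- **A bonus pays the LAST incidence before the new one**: every incidence younger than the bonus witness would be visible.
[folklore] -/
theorem no_incidence_between (hτ : 2 ≤ τ) {t : ℕ} (ht : t < n) {b : Fin d × Bool} {q₁ : Site d × ℕ}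
    (hq₁ : bonusWit τ kc (danger τ (pre a₀ γ t)) (γ ⟨t, ht⟩) b q₁ = true) {i : ℕ} (hi : i < t)
    (hadj : (zdGraph d).Adj (wordPos γ i) (nsite γ t b)) : t - i = q₁.2 ∨ q₁.2 + kc < t - i := by
  obtain ⟨hq₁v, hτ3, hall⟩ := (bonusWit_iff τ kc).1 hq₁
  by_cases hlt : t - i + 3 ≤ τ
  · exact hall _ (mem_cvis_of_adj a₀ hτ ht hi hlt hadj)
  · right; omega

/-- **Injectivity of the records** on the payment slots of one world. [folklore] -/
theorem crec_injOn (hτ : 2 ≤ τ) {o : Orders d n} :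
    Set.InjOn (crec a₀ τ γ) (cslots a₀ τ kc γ o : Set (ℕ × Bool × (Fin d × Bool))) := by
  -- the key asymmetric facts
  -- (1) a new-incidence record never equals a bonus record
  have hAB : ∀ {t t' : ℕ} (ht : t < n) (ht' : t' < n) {b b' : Fin d × Bool},
      cactive kc (danger τ (pre a₀ γ t)) (γ ⟨t, ht⟩) b = true →
      (∃ q₁, bonusWit τ kc (danger τ (pre a₀ γ t')) (γ ⟨t', ht'⟩) b' q₁ = true) →
      nsite γ t b = nsite γ t' b' → t + 1 ≠ t' - cminAge (danger τ (pre a₀ γ t')) (γ ⟨t', ht'⟩) b' := by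
    intro t t' ht ht' b b' hact hbon hW heq
    obtain ⟨q₁, hq₁⟩ := hbon
    rw [cminAge_eq_of_bonusWit hq₁] at heq
    obtain ⟨-, hτ3, -⟩ := (bonusWit_iff τ kc).1 hq₁
    obtain ⟨-, q0, hq0, hkc⟩ := (cactive_iff kc).1 hact
    obtain ⟨h01, h0t, -, hadj0⟩ := cvis_spec a₀ ht hq0
    have hq₁t : q₁.2 ≤ t' := (cvis_spec a₀ ht' ((bonusWit_iff τ kc).1 hq₁).1).2.1
    -- the incidence t - q0.2 is visible at time t' with age in (j₁, j₁ + kc]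
    rw [hW] at hadj0
    rcases no_incidence_between a₀ hτ ht' hq₁ (i := t - q0.2) (by omega) hadj0 with h | h <;> omega
  -- (2) two bonus records with the same site and index come from the same step
  have hBB : ∀ {t t' : ℕ} (ht : t < n) (ht' : t' < n) {b b' : Fin d × Bool}, t < t' →
      (∃ q₁, bonusWit τ kc (danger τ (pre a₀ γ t)) (γ ⟨t, ht⟩) b q₁ = true) →
      (∃ q₁, bonusWit τ kc (danger τ (pre a₀ γ t')) (γ ⟨t', ht'⟩) b' q₁ = true) →
      nsite γ t b = nsite γ t' b' →
      t - cminAge (danger τ (pre a₀ γ t)) (γ ⟨t, ht⟩) b ≠ t' - cminAge (danger τ (pre a₀ γ t')) (γ ⟨t', ht'⟩) b' := by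
    intro t t' ht ht' b b' htt hb hb' hW heq
    obtain ⟨q₁, hq₁⟩ := hb
    obtain ⟨q₁', hq₁'⟩ := hb'
    rw [cminAge_eq_of_bonusWit hq₁, cminAge_eq_of_bonusWit hq₁'] at heq
    have h1 := (cvis_spec a₀ ht ((bonusWit_iff τ kc).1 hq₁).1).1
    -- parity: t+1 and t'+1 are both incidences of the site, so t' ≥ t + 2
    have hpar := mod_two_eq_of_adj_adj γ (by omega : t + 1 ≤ n) (by omega : t' + 1 ≤ n)
      (adj_succ_nsite (γ := γ) t b) (by rw [hW]; exact adj_succ_nsite (γ := γ) t' b')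
    have ht2 : t + 2 ≤ t' := by omega
    -- the incidence t+1 at time t': its age t'-t-1 is either j₁' or beyond j₁'+kc; in both cases t'-j₁' ≥ t+1
    have hA : (zdGraph d).Adj (wordPos γ (t + 1)) (nsite γ t' b') := by rw [← hW]; exact adj_succ_nsite t b
    rcases no_incidence_between a₀ hτ ht' hq₁' (i := t + 1) (by omega) hA with h | h <;> omega
  -- now the case analysis
  rintro ⟨t, β, b⟩ hx ⟨t', β', b'⟩ hx' heq
  obtain ⟨ht, hb, hβ⟩ := (mem_cslots a₀).1 hx
  obtain ⟨ht', hb', hβ'⟩ := (mem_cslots a₀).1 hx'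
  simp only at ht hb hβ ht' hb' hβ'
  have hact := (mem_filter.1 hb).2.1
  have hact' := (mem_filter.1 hb').2.1
  simp only [crec, Prod.mk.injEq, wordAt_of_lt a₀ γ ht, wordAt_of_lt a₀ γ ht'] at heq
  obtain ⟨hW, hidx⟩ := heq
  have hbb : t = t' → b = b' := by
    rintro rfl
    have := hW
    simp only [nsite] at this
    exact stepVec_injective (add_left_cancel this)
  cases β <;> cases β' <;> simp only [if_true, Bool.false_eq_true, if_false] at hidx
  · -- new / new
    have htt : t = t' := by omega
    subst htt; rw [hbb rfl]
  · -- new / bonus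
    exact absurd hidx (hAB ht ht' hact ((cbonus_iff τ kc).1 (hβ' rfl)) hW)
  · -- bonus / new
    exact absurd hidx.symm (hAB ht' ht hact' ((cbonus_iff τ kc).1 (hβ rfl)) hW.symm)
  · -- bonus / bonus
    rcases lt_trichotomy t t' with hlt | rfl | hgt
    · exact absurd hidx (hBB ht ht' hlt ((cbonus_iff τ kc).1 (hβ rfl)) ((cbonus_iff τ kc).1 (hβ' rfl)) hW)
    · rw [hbb rfl]
    · exact absurd hidx.symm (hBB ht' ht hgt ((cbonus_iff τ kc).1 (hβ' rfl)) ((cbonus_iff τ kc).1 (hβ rfl)) hW.symm)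

end Records

/-! ### Averaging the corner coins over the sibling orders (step-dependent exponents) -/

section Coins

variable {n : ℕ}

/-- The coin factor of the node `s` with exponent `c`, read through a permutation `σ` of the directions: `q^c` if `σ` puts
step `s+1` before step `s`, else `1` (junk `1` for `s + 2 > n`). [folklore] -/
def nodeCoinFactor (q : ℝ) (c : ℕ) (γ : Fin n → Fin d × Bool) (s : Fin n) (σ : Equiv.Perm (Fin d × Bool)) : ℝ :=
  if h : (s : ℕ) + 2 ≤ n then
    (if dirCode (σ (γ ⟨s + 1, by omega⟩)) < dirCode (σ (γ ⟨s, by omega⟩)) then q ^ c else 1)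
  else 1

/-- The coin factor read through `o` is `q^c` on bad nodes and `1` otherwise (for `s + 2 ≤ n`). [folklore] -/
theorem coinFactor_eq_ite (q : ℝ) (c : ℕ) (o : Orders d n) (γ : Fin n → Fin d × Bool) (s : Fin n) (h : (s : ℕ) + 2 ≤ n)
    [Decidable (IsBad o γ s)] :
    nodeCoinFactor q c γ s (o (pnode γ s)) = if IsBad o γ s then q ^ c else 1 := by
  obtain ⟨k, hk⟩ := s
  unfold nodeCoinFactor IsBad
  dsimp only at h ⊢
  rw [dif_pos h]
  by_cases hlt : dirCode (o (pnode γ ⟨k, hk⟩) (γ ⟨k + 1, by omega⟩)) < dirCode (o (pnode γ ⟨k, hk⟩) (γ ⟨k, hk⟩))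
  · rw [if_pos hlt, if_pos ⟨h, hlt⟩]
  · rw [if_neg hlt, if_neg fun hh => hlt hh.2]

/-- Reindexing a product over the steps `t < n` with trivial first factor by the nodes `s = t - 1`, `s + 2 ≤ n`. [folklore] -/
theorem prod_range_eq_prod_nodes (G : ℕ → ℝ) (h0 : G 0 = 1) :
    ∏ t ∈ range n, G t = ∏ s ∈ (univ : Finset (Fin n)).filter (fun s : Fin n => s.1 + 2 ≤ n), G (s.1 + 1) := by
  cases n with
  | zero => simp
  | succ m =>
    rw [prod_range_succ', h0, mul_one]
    refine Finset.prod_bij (fun t ht => ⟨t, by have := mem_range.1 ht; omega⟩) (fun t ht => ?_) (fun t₁ _ t₂ _ h => ?_)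
      (fun s hs => ?_) (fun t _ => rfl)
    · have := mem_range.1 ht
      exact mem_filter.2 ⟨mem_univ _, by simp only; omega⟩
    · simpa using congrArg Fin.val h
    · have := (mem_filter.1 hs).2
      exact ⟨s.1, mem_range.2 (by omega), Fin.ext rfl⟩

/-- **Averaging with node-dependent exponents.** For a set `CS` of nodes `s` (`s + 2 ≤ n`; the two steps at `s` distinct whenever
the exponent `c s` is nonzero), `Σ_o Π_{s ∈ CS} (q^{c s} if the node is bad for o, else 1) = #Orders · Π_{s ∈ CS} (1 + q^{c s})/2`:
the coins are fair and independent. [folklore] -/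

theorem sum_orders_prod_coin (q : ℝ) (γ : Fin n → Fin d × Bool) (CS : Finset (Fin n)) (c : Fin n → ℕ)
    (hCS : ∀ s ∈ CS, ∃ h : (s : ℕ) + 2 ≤ n, c s ≠ 0 → γ ⟨s, by omega⟩ ≠ γ ⟨s + 1, by omega⟩)
    [∀ o : Orders d n, ∀ s, Decidable (IsBad o γ s)] :
    ∑ o : Orders d n, ∏ s ∈ CS, (if IsBad o γ s then q ^ c s else 1) =
      Fintype.card (Orders d n) * ∏ s ∈ CS, (1 + q ^ c s) / 2 := by
  classical
  set Φ : PNode d n → Equiv.Perm (Fin d × Bool) → ℝ :=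
    fun u σ => ∏ s ∈ CS.filter (fun s => pnode γ s = u), nodeCoinFactor q (c s) γ s σ with hΦ
  have h1 : ∀ o : Orders d n, ∏ s ∈ CS, (if IsBad o γ s then q ^ c s else 1) = ∏ u, Φ u (o u) := by
    intro o
    rw [← prod_fiberwise CS (pnode γ)]
    refine prod_congr rfl fun u _ => prod_congr rfl fun s hs => ?_
    obtain ⟨hsC, hsu⟩ := mem_filter.1 hs
    obtain ⟨h, -⟩ := hCS s hsC
    rw [← hsu, coinFactor_eq_ite q (c s) o γ s h]
  set g : PNode d n → ℝ := fun u => ∏ s ∈ CS.filter (fun s => pnode γ s = u), (1 + q ^ c s) / 2 with hg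
  have h2 : ∀ u, ∑ σ, Φ u σ = Fintype.card (Equiv.Perm (Fin d × Bool)) * g u := by
    intro u
    by_cases hu : u ∈ CS.image (pnode γ)
    · obtain ⟨s₀, hs₀, hu0⟩ := mem_image.1 hu
      have hfilter : CS.filter (fun s => pnode γ s = u) = {s₀} := by
        ext s
        rw [mem_filter, mem_singleton]
        constructor
        · rintro ⟨-, h⟩; exact pnode_injective γ (h.trans hu0.symm)
        · rintro rfl; exact ⟨hs₀, hu0⟩
      simp only [hΦ, hg, hfilter, prod_singleton]
      obtain ⟨h, hab⟩ := hCS s₀ hs₀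
      simp only [nodeCoinFactor, dif_pos h]
      by_cases hc : c s₀ = 0
      · simp only [hc, pow_zero, ite_self, sum_const, card_univ, nsmul_eq_mul, mul_one]; ring
      · exact sum_perm_cornerCoin (q ^ c s₀) dirCode dirCode_injective (hab hc)
    · have hfilter : CS.filter (fun s => pnode γ s = u) = ∅ := by
        rw [filter_eq_empty_iff]
        intro s hs he
        exact hu (mem_image.2 ⟨s, hs, he⟩)
      simp only [hΦ, hg, hfilter, prod_empty, sum_const, card_univ, nsmul_eq_mul, mul_one]
  simp_rw [h1]
  rw [← Fintype.prod_sum]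
  simp_rw [h2]
  rw [prod_mul_distrib, prod_const, card_univ, Fintype.card_fun]
  push_cast
  congr 1
  rw [hg, prod_fiberwise CS (pnode γ) (fun s => (1 + q ^ c s) / 2)]

end Coins


end Summit.CriticalPhenomena.PercolationContinuityZ3.Theorems.Pcint
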